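import Summits.CriticalPhenomena.Ising3DConformalLimit.Theorems.LinkingParityCirclesSpinRatioMoebiusPinnedLimit
import Summits.CriticalPhenomena.Ising3DConformalLimit.Theorems.LinkingParityCirclesSpinRatioMoebiusStubProdPairsLe
import Summits.CriticalPhenomena.Ising3DConformalLimit.Theorems.LinkingParityCirclesSpinRatioMoebiusStubRatioLimitOfScalingLimit
import Summits.CriticalPhenomena.Ising3DConformalLimit.Theorems.LinkingParityCirclesSpinRatioMoebiusStubRatioInversionOfCCI
import Summits.CriticalPhenomena.Ising3DConformalLimit.Theorems.LinkingParityCirclesSpinRatioMoebiusStubRatioOfCovariantFamily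
import Summits.CriticalPhenomena.Ising3DConformalLimit.Theorems.LinkingParityCirclesSpinRatioMoebiusStubInversionCovariantOfInvariantRatios
import Summits.CriticalPhenomena.Ising3DConformalLimit.Theorems.LinkingParityCirclesSpinRatioMoebiusStubTelescopingLimitOfScalingLimit
import Summits.CriticalPhenomena.Ising3DConformalLimit.Theorems.LinkingParityCirclesSpinRatioMoebiusStubCCIRatioRotationOfLimit
import Summits.CriticalPhenomena.Ising3DConformalLimit.Theorems.LinkingParityCirclesSpinRatioMoebiusStubCCIRatioInversionOfLimit
import Summits.CriticalPhenomena.Ising3DConformalLimit.Theorems.LinkingParityCirclesSpinRatioMoebiusRatioLimitExistsOfCCI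
import Summits.CriticalPhenomena.Ising3DConformalLimit.Theorems.MoebiusLimitExists.Negative.CruxInversionOnly
import Summits.CriticalPhenomena.Ising3DConformalLimit.Theses.EnergyNotSigmaSquared
import Summits.CriticalPhenomena.Ising3DConformalLimit.Theses.PrimaryAtInfinity
import Summits.CriticalPhenomena.Ising3DConformalLimit.Theses.HyperoctahedralRP
import Summits.CriticalPhenomena.Ising3DConformalLimit.Theses.CurrentConnectionInvariance
import Summits.CriticalPhenomena.Ising3DConformalLimit.Statement
import Literature.Probability.LatticeModels.ScalingLimit3D
import HarnessLib

/-!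
# Crux `LinkingParityCircles.SpinRatioMoebius` (stmt-CriticalPhenomena-4530) PINNED in the DAG of existing items:
# `SpinRatioMoebius ⇔ MoebiusLimit (1344) ⇔ RatioLimit (4841) ∧ RatioInversionInvariance (4840)`

The crux of route `LinkingParityCircles` ("the k = 0 corner": Möbius INVARIANT scaling limits `q` of the weight-free spin
pairing ratios `Q^δ_m = ⟨∏σ_{[xᵢ/δ]}⟩ / ∏_j ⟨σ_{[x_j/δ]}σ_{[x_{j+m}/δ]}⟩` of the critical Ising model on `ℤ³`) is EQUIVALENT to
the shared item stmt-CriticalPhenomena-1344 `MoebiusLimit` (the conjunct `Ising3DConformalLimit` minus clause (iii): a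
non-degenerate Möbius covariant pointwise scaling limit exists) and to the conjunction of the two cruxes
stmt-CriticalPhenomena-4841 `RatioLimit` and stmt-CriticalPhenomena-4840 `RatioInversionInvariance` of the sibling route
`CurrentConnectionInvariance` (kill criterion (d) of `LinkingParityCircles`, kernel-checked); moreover the existence
half `∃ q, Q^δ_m → q_{2m}` is equivalent to item 4841 alone, item 4841 implies item 4842 `RatioRotationInvariance`, and
the crux follows from `∃ q` together with item 1982 `HyperoctahedralRP.InversionUpgradeNormalised`.  In particular the crux
is NECESSARY for the summit conjunct (`SpinRatioMoebius_of_conformalLimit`).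

Ingredients (all landed for line `registered` of this crux): ratio limits from any non-degenerate scaling limit
(`stub_ratioLimitOfScalingLimit`), Möbius invariance of pairing quotients (`stub_ratioOfCovariantFamily`), the pinned
limit of a family of ratio limits (`pinnedLimit_of_ratioLimits`: Euclidean invariance and scale covariance are free,
`O(3)` by the `HyperoctahedralRP` rigidity), inversion covariance of the pinned limit from inversion invariance of the
ratios (`stub_inversionCovariantOfInvariantRatios`), the telescoping ratios under a scaling limit
(`stub_telescopingLimitOfScalingLimit`, `stub_CCIRatioRotationOfLimit`, `stub_CCIRatioInversionOfLimit`), the bridges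
`ratioLimitExists_of_CCIRatioLimit` (4841 ⇒ ratio limits) and `stub_ratioInversionOfCCI` (4840 ⇒ inversion, with the GKS
bound `stub_prodPairsLe`), and `MoebiusLimitExistsNegative.moebiusLimit_iff_inversion` (item 1344 = existence + unit-inversion
covariance).

References: H. Duminil-Copin, Proc. ICM 2022 §8.1, §8.4 (the statements are open on `ℤ³`); P. Di Francesco,
P. Mathieu, D. Sénéchal (Springer 1997) §4.3.1 (covariance of quasi-primary correlators).
-/

noncomputable section

namespace Summit.CriticalPhenomena.Ising3DConformalLimit.Cruxes.SpinRatioMoebius.Birth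

open Literature.Probability.LatticeModels Filter Set
open Summit.CriticalPhenomena.Ising3DConformalLimit.Theses
open Summit.CriticalPhenomena.Ising3DConformalLimit.MoebiusLimitExistsNegative (moebiusLimit_iff_inversion)
open scoped Topology

/-! ## §A Ratio limits from scaling limits (item 1344 / 1981 / 5355 / conjunct ⇒ the existence half) -/

/-- Packaging of level-indexed functions `g m : (ℝ³)^{m+m} → ℝ` into a `CorrFamily 3` (read the first `n/2 + n/2`
coordinates at arity `n`). [folklore] -/
theorem exists_corrFamily_of_levels (g : (m : ℕ) → (Fin (m + m) → EuclideanSpace ℝ (Fin 3)) → ℝ) :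
    ∃ q : CorrFamily 3, ∀ (m : ℕ) (x : Fin (m + m) → EuclideanSpace ℝ (Fin 3)), q (m + m) x = g m x := by
  refine ⟨fun n x => g (n / 2) (fun i => x (Fin.castLE (by omega) i)), fun m x => ?_⟩
  have key : ∀ (k : ℕ) (hk : k = m) (h : k + k ≤ m + m), g k (fun i => x (Fin.castLE h i)) = g m x := by
    intro k hk h
    subst hk
    rfl
  exact key ((m + m) / 2) (by omega) _

/-- **Ratio limits from ANY non-degenerate pointwise scaling limit** (the existence half of the crux). [folklore] -/
theorem ratioLimits_of_scalingLimit {ρ : ℝ → ℝ} {S : CorrFamily 3} (hρ : ∀ δ ∈ Set.Ioc (0 : ℝ) 1, 0 < ρ δ)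
    (hlim : HasPointwiseScalingLimit (criticalCorr 3) ρ S) (hnd : IsNondegenerateTwoPoint S) :
    ∃ q : CorrFamily 3, ∀ m : ℕ, TendstoLocallyUniformlyOn (fun (δ : ℝ) (x : Fin (m + m) → EuclideanSpace ℝ (Fin 3)) =>
      criticalCorr 3 (m + m) (fun i => latticeApprox δ (x i)) /
        ∏ j : Fin m, criticalCorr 3 2 ![latticeApprox δ (x (Fin.castAdd m j)), latticeApprox δ (x (Fin.natAdd m j))])
      (q (m + m)) (𝓝[>] (0 : ℝ)) (NonCoincident 3 (m + m)) := by
  obtain ⟨q, hq⟩ := exists_corrFamily_of_levels fun m x =>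
    S (m + m) x / ∏ j : Fin m, S 2 ![x (Fin.castAdd m j), x (Fin.natAdd m j)]
  exact ⟨q, fun m => (stub_ratioLimitOfScalingLimit ρ S hρ hlim hnd m).congr_right fun x _ => (hq m x).symm⟩

/-- Item stmt-CriticalPhenomena-1981 `HyperoctahedralRP.ExistsScaleCovariantLimit` ⇒ ratio limits. [folklore] -/
theorem ratioLimits_of_existsScaleCovariantLimit (h : HyperoctahedralRP.ExistsScaleCovariantLimit) :
    ∃ q : CorrFamily 3, ∀ m : ℕ, TendstoLocallyUniformlyOn (fun (δ : ℝ) (x : Fin (m + m) → EuclideanSpace ℝ (Fin 3)) =>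
      criticalCorr 3 (m + m) (fun i => latticeApprox δ (x i)) /
        ∏ j : Fin m, criticalCorr 3 2 ![latticeApprox δ (x (Fin.castAdd m j)), latticeApprox δ (x (Fin.natAdd m j))])
      (q (m + m)) (𝓝[>] (0 : ℝ)) (NonCoincident 3 (m + m)) := by
  obtain ⟨_, _, _, hρ, _, hlim, _, hnd, _, _⟩ := h
  exact ratioLimits_of_scalingLimit hρ hlim hnd

/-- Item stmt-CriticalPhenomena-5355 `PrimaryAtInfinity.ExistsRegularLimit` ⇒ ratio limits. [folklore] -/
theorem ratioLimits_of_existsRegularLimit (h : PrimaryAtInfinity.ExistsRegularLimit) :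
    ∃ q : CorrFamily 3, ∀ m : ℕ, TendstoLocallyUniformlyOn (fun (δ : ℝ) (x : Fin (m + m) → EuclideanSpace ℝ (Fin 3)) =>
      criticalCorr 3 (m + m) (fun i => latticeApprox δ (x i)) /
        ∏ j : Fin m, criticalCorr 3 2 ![latticeApprox δ (x (Fin.castAdd m j)), latticeApprox δ (x (Fin.natAdd m j))])
      (q (m + m)) (𝓝[>] (0 : ℝ)) (NonCoincident 3 (m + m)) := by
  obtain ⟨_, _, hρ, hlim, _, hnd, _, _, _⟩ := h
  exact ratioLimits_of_scalingLimit hρ hlim hnd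

/-- Item stmt-CriticalPhenomena-1344 `MoebiusLimit` ⇒ ratio limits. [folklore] -/
theorem ratioLimits_of_moebiusLimit (h : EnergyNotSigmaSquared.MoebiusLimit) :
    ∃ q : CorrFamily 3, ∀ m : ℕ, TendstoLocallyUniformlyOn (fun (δ : ℝ) (x : Fin (m + m) → EuclideanSpace ℝ (Fin 3)) =>
      criticalCorr 3 (m + m) (fun i => latticeApprox δ (x i)) /
        ∏ j : Fin m, criticalCorr 3 2 ![latticeApprox δ (x (Fin.castAdd m j)), latticeApprox δ (x (Fin.natAdd m j))])
      (q (m + m)) (𝓝[>] (0 : ℝ)) (NonCoincident 3 (m + m)) := by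
  obtain ⟨_, _, _, hρ, _, hlim, hnd, _⟩ := h
  exact ratioLimits_of_scalingLimit hρ hlim hnd

/-! ## §B `MoebiusLimit (1344) ⇒ SpinRatioMoebius`: the crux is NECESSARY for the conjunct -/

/-- **Item stmt-CriticalPhenomena-1344 `MoebiusLimit` ⇒ the crux**: the normalised pairing quotients
`S_{2m}/∏_j S_2(x_j, x_{j+m})` of a Möbius covariant non-degenerate scaling limit are a Möbius INVARIANT family of ratio
limits. [folklore] -/
theorem SpinRatioMoebius_of_moebiusLimit (h : EnergyNotSigmaSquared.MoebiusLimit) :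
    LinkingParityCircles.SpinRatioMoebius := by
  classical
  obtain ⟨ρ, Δ, S, hρ, -, hlim, hnd, hM⟩ := h
  obtain ⟨q, hq⟩ := exists_corrFamily_of_levels fun m x =>
    S (m + m) x / ∏ j : Fin m, S 2 ![x (Fin.castAdd m j), x (Fin.natAdd m j)]
  have hconv : ∀ m : ℕ, TendstoLocallyUniformlyOn (fun (δ : ℝ) (x : Fin (m + m) → EuclideanSpace ℝ (Fin 3)) =>
      criticalCorr 3 (m + m) (fun i => latticeApprox δ (x i)) /
        ∏ j : Fin m, criticalCorr 3 2 ![latticeApprox δ (x (Fin.castAdd m j)), latticeApprox δ (x (Fin.natAdd m j))])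
      (q (m + m)) (𝓝[>] (0 : ℝ)) (NonCoincident 3 (m + m)) :=
    fun m => (stub_ratioLimitOfScalingLimit ρ S hρ hlim hnd m).congr_right fun x _ => (hq m x).symm
  have h10 := stub_ratioOfCovariantFamily Δ S hM
  refine ⟨fun n x => if Even n ∧ x ∈ NonCoincident 3 n then q n x else 0, ⟨⟨?_, ?_⟩, ?_, ?_⟩, ?_⟩
  · -- translations
    intro n v x
    beta_reduce
    have hφ : Function.Injective (fun y : EuclideanSpace ℝ (Fin 3) => y + v) := add_left_injective v
    by_cases h : Even n ∧ x ∈ NonCoincident 3 n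
    · obtain ⟨⟨m, rfl⟩, hx⟩ := h
      have hxv : (fun i => x i + v) ∈ NonCoincident 3 (m + m) := (comp_mem_nonCoincident_iff_of_injective hφ x).2 hx
      rw [if_pos ⟨⟨m, rfl⟩, hxv⟩, if_pos ⟨⟨m, rfl⟩, hx⟩, hq, hq]
      exact (h10 m x).1 v
    · have h' : ¬ (Even n ∧ (fun i => x i + v) ∈ NonCoincident 3 n) := fun hh =>
        h ⟨hh.1, (comp_mem_nonCoincident_iff_of_injective hφ x).1 hh.2⟩
      rw [if_neg h', if_neg h]
  · -- linear isometries
    intro n A x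
    beta_reduce
    by_cases h : Even n ∧ x ∈ NonCoincident 3 n
    · obtain ⟨⟨m, rfl⟩, hx⟩ := h
      have hAx : (fun i => A (x i)) ∈ NonCoincident 3 (m + m) := (comp_mem_nonCoincident_iff_of_injective A.injective x).2 hx
      rw [if_pos ⟨⟨m, rfl⟩, hAx⟩, if_pos ⟨⟨m, rfl⟩, hx⟩, hq, hq]
      exact (h10 m x).2.1 A
    · have h' : ¬ (Even n ∧ (fun i => A (x i)) ∈ NonCoincident 3 n) := fun hh =>
        h ⟨hh.1, (comp_mem_nonCoincident_iff_of_injective A.injective x).1 hh.2⟩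
      rw [if_neg h', if_neg h]
  · -- dilations, weight 0
    intro n c hc x
    beta_reduce
    have hc1 : c ^ (-(n : ℝ) * 0) = 1 := by
      rw [mul_zero, Real.rpow_zero]
    rw [hc1, one_mul]
    have hφ : Function.Injective (fun y : EuclideanSpace ℝ (Fin 3) => c • y) := smul_right_injective _ hc.ne'
    by_cases h : Even n ∧ x ∈ NonCoincident 3 n
    · obtain ⟨⟨m, rfl⟩, hx⟩ := h
      have hcx : (fun i => c • x i) ∈ NonCoincident 3 (m + m) := (comp_mem_nonCoincident_iff_of_injective hφ x).2 hx
      rw [if_pos ⟨⟨m, rfl⟩, hcx⟩, if_pos ⟨⟨m, rfl⟩, hx⟩, hq, hq]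
      exact (h10 m x).2.2.1 c hc
    · have h' : ¬ (Even n ∧ (fun i => c • x i) ∈ NonCoincident 3 n) := fun hh =>
        h ⟨hh.1, (comp_mem_nonCoincident_iff_of_injective hφ x).1 hh.2⟩
      rw [if_neg h', if_neg h]
  · -- the unit inversion, weight 0
    intro n x hx0
    beta_reduce
    have hw : (∏ i : Fin n, ‖x i‖ ^ (2 * (0 : ℝ))) = 1 := by
      simp
    rw [hw, one_mul]
    have hφ : Function.Injective (EuclideanGeometry.inversion (0 : EuclideanSpace ℝ (Fin 3)) 1) :=
      EuclideanGeometry.inversion_injective _ one_ne_zero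
    by_cases h : Even n ∧ x ∈ NonCoincident 3 n
    · obtain ⟨⟨m, rfl⟩, hx⟩ := h
      have hix : (fun i => EuclideanGeometry.inversion 0 1 (x i)) ∈ NonCoincident 3 (m + m) :=
        (comp_mem_nonCoincident_iff_of_injective hφ x).2 hx
      rw [if_pos ⟨⟨m, rfl⟩, hix⟩, if_pos ⟨⟨m, rfl⟩, hx⟩, hq, hq]
      exact (h10 m x).2.2.2 hx0
    · have h' : ¬ (Even n ∧ (fun i => EuclideanGeometry.inversion 0 1 (x i)) ∈ NonCoincident 3 n) := fun hh =>
        h ⟨hh.1, (comp_mem_nonCoincident_iff_of_injective hφ x).1 hh.2⟩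
      rw [if_neg h', if_neg h]
  · -- the convergence clause survives the normalisation
    intro m
    exact (hconv m).congr_right fun x hx => (if_pos (show Even (m + m) ∧ x ∈ NonCoincident 3 (m + m) from ⟨⟨m, rfl⟩, hx⟩)).symm

/-- **The crux is necessary for the summit conjunct**: `Ising3DConformalLimit → SpinRatioMoebius`. [folklore] -/
theorem SpinRatioMoebius_of_conformalLimit (h : _root_.Ising3DConformalLimit) : LinkingParityCircles.SpinRatioMoebius := by
  obtain ⟨ρ, Δ, S, hρ, hΔ, hlim, hnd, hM, -⟩ := h
  exact SpinRatioMoebius_of_moebiusLimit ⟨ρ, Δ, S, hρ, hΔ, hlim, hnd, hM⟩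

/-! ## §C `SpinRatioMoebius ⇒ MoebiusLimit (1344)`, and the crux from ratio limits + an inversion input -/

/-- **Ratio limits at every level that are inversion INVARIANT on the locus give item 1344**: the pinned limit is
inversion covariant (`stub_inversionCovariantOfInvariantRatios`), and existence + unit-inversion covariance is
`MoebiusLimit` (`moebiusLimit_iff_inversion`). [folklore] -/
theorem moebiusLimit_of_ratioLimits_of_invariant {q : CorrFamily 3}
    (hq : ∀ m : ℕ, TendstoLocallyUniformlyOn (fun (δ : ℝ) (x : Fin (m + m) → EuclideanSpace ℝ (Fin 3)) =>
      criticalCorr 3 (m + m) (fun i => latticeApprox δ (x i)) /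
        ∏ j : Fin m, criticalCorr 3 2 ![latticeApprox δ (x (Fin.castAdd m j)), latticeApprox δ (x (Fin.natAdd m j))])
      (q (m + m)) (𝓝[>] (0 : ℝ)) (NonCoincident 3 (m + m)))
    (hqinv : ∀ m : ℕ, ∀ x ∈ NonCoincident 3 (m + m), (∀ i, x i ≠ 0) →
      q (m + m) (fun i => EuclideanGeometry.inversion 0 1 (x i)) = q (m + m) x) :
    EnergyNotSigmaSquared.MoebiusLimit := by
  obtain ⟨ρ, Δ, ψ, S, hρ, hS, hnorm, hnd, -, hsc, hrot, hψpos, hform, hS2⟩ := pinnedLimit_of_ratioLimits hq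
  exact moebiusLimit_iff_inversion.2
    ⟨ρ, Δ, S, hρ, hS, hnd, stub_inversionCovariantOfInvariantRatios ρ Δ ψ S q hS hnorm hsc hrot hψpos hform hS2 hqinv⟩

/-- **The crux ⇒ item stmt-CriticalPhenomena-1344 `MoebiusLimit`.** [folklore] -/
theorem moebiusLimit_of_SpinRatioMoebius (h : LinkingParityCircles.SpinRatioMoebius) : EnergyNotSigmaSquared.MoebiusLimit := by
  obtain ⟨q, hMq, hq⟩ := h
  refine moebiusLimit_of_ratioLimits_of_invariant hq fun m x _ hx0 => ?_
  have h := hMq.2.2 (m + m) x hx0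
  have hw : (∏ i : Fin (m + m), ‖x i‖ ^ (2 * (0 : ℝ))) = 1 := by simp
  rw [hw, one_mul] at h
  exact h

/-- **`SpinRatioMoebius ⇔ MoebiusLimit`**: the k = 0 corner of route `LinkingParityCircles` IS the shared item
stmt-CriticalPhenomena-1344 (the conjunct minus clause (iii)). [folklore] -/
theorem SpinRatioMoebius_iff_moebiusLimit :
    Summit.CriticalPhenomena.Ising3DConformalLimit.Theses.LinkingParityCircles.SpinRatioMoebius ↔ Summit.CriticalPhenomena.Ising3DConformalLimit.Theses.EnergyNotSigmaSquared.MoebiusLimit :=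
  ⟨moebiusLimit_of_SpinRatioMoebius, SpinRatioMoebius_of_moebiusLimit⟩

/-- **The crux from ratio limits and ASYMPTOTIC INVERSION INVARIANCE ON THE LATTICE** (the two open stubs of line
`registered`, composed through item 1344). [folklore] -/
theorem SpinRatioMoebius_of_ratioLimits_of_ratioInversion
    (hL : ∃ q : CorrFamily 3, ∀ m : ℕ, TendstoLocallyUniformlyOn (fun (δ : ℝ) (x : Fin (m + m) → EuclideanSpace ℝ (Fin 3)) =>
      criticalCorr 3 (m + m) (fun i => latticeApprox δ (x i)) /
        ∏ j : Fin m, criticalCorr 3 2 ![latticeApprox δ (x (Fin.castAdd m j)), latticeApprox δ (x (Fin.natAdd m j))])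
      (q (m + m)) (𝓝[>] (0 : ℝ)) (NonCoincident 3 (m + m)))
    (hI : ∀ (m : ℕ), ∀ x ∈ NonCoincident 3 (m + m), (∀ i, x i ≠ 0) → Tendsto (fun δ : ℝ =>
      criticalCorr 3 (m + m) (fun i => latticeApprox δ (EuclideanGeometry.inversion 0 1 (x i))) /
          (∏ j : Fin m, criticalCorr 3 2 ![latticeApprox δ (EuclideanGeometry.inversion 0 1 (x (Fin.castAdd m j))),
            latticeApprox δ (EuclideanGeometry.inversion 0 1 (x (Fin.natAdd m j)))]) -
        criticalCorr 3 (m + m) (fun i => latticeApprox δ (x i)) /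
          (∏ j : Fin m, criticalCorr 3 2 ![latticeApprox δ (x (Fin.castAdd m j)), latticeApprox δ (x (Fin.natAdd m j))]))
      (𝓝[>] (0 : ℝ)) (𝓝 0)) :
    LinkingParityCircles.SpinRatioMoebius := by
  obtain ⟨q, hq⟩ := hL
  refine SpinRatioMoebius_of_moebiusLimit (moebiusLimit_of_ratioLimits_of_invariant hq fun m x hx hx0 => ?_)
  have hιx : (fun i => EuclideanGeometry.inversion 0 1 (x i)) ∈ NonCoincident 3 (m + m) :=
    (comp_mem_nonCoincident_iff_of_injective (EuclideanGeometry.inversion_injective _ one_ne_zero) x).2 hx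
  exact locallyUniformLimit_eq_of_tendsto_sub (hq m) hx hιx (hI m x hx hx0)

/-- **The crux from ratio limits and item stmt-CriticalPhenomena-1982 `HyperoctahedralRP.InversionUpgradeNormalised`**
(the upgrade applied to the pinned limit). [folklore] -/
theorem SpinRatioMoebius_of_ratioLimits_of_inversionUpgrade
    (hL : ∃ q : CorrFamily 3, ∀ m : ℕ, TendstoLocallyUniformlyOn (fun (δ : ℝ) (x : Fin (m + m) → EuclideanSpace ℝ (Fin 3)) =>
      criticalCorr 3 (m + m) (fun i => latticeApprox δ (x i)) /
        ∏ j : Fin m, criticalCorr 3 2 ![latticeApprox δ (x (Fin.castAdd m j)), latticeApprox δ (x (Fin.natAdd m j))])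
      (q (m + m)) (𝓝[>] (0 : ℝ)) (NonCoincident 3 (m + m)))
    (hU : HyperoctahedralRP.InversionUpgradeNormalised) : LinkingParityCircles.SpinRatioMoebius := by
  obtain ⟨q, hq⟩ := hL
  obtain ⟨ρ, Δ, ψ, S, hρ, hS, hnorm, hnd, htr, hsc, hrot, -⟩ := pinnedLimit_of_ratioLimits hq
  exact SpinRatioMoebius_of_moebiusLimit
    (moebiusLimit_iff_inversion.2 ⟨ρ, Δ, S, hρ, hS, hnd, hU ρ Δ S hρ hS hnorm hnd ⟨htr, hrot⟩ hsc⟩)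

/-! ## §D The telescoping ratios of route `CurrentConnectionInvariance` (items 4841, 4842, 4840) -/

/-- **Item 4841 `RatioLimit` from ANY non-degenerate pointwise scaling limit.** [folklore] -/
theorem CCIRatioLimit_of_scalingLimit {ρ : ℝ → ℝ} {S : CorrFamily 3} (hρ : ∀ δ ∈ Set.Ioc (0 : ℝ) 1, 0 < ρ δ)
    (hlim : HasPointwiseScalingLimit (criticalCorr 3) ρ S) (hnd : IsNondegenerateTwoPoint S) :
    CurrentConnectionInvariance.RatioLimit := by
  intro n hn _
  obtain ⟨hc, hpos, hT⟩ := stub_telescopingLimitOfScalingLimit ρ S hρ hlim hnd n hn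
  exact ⟨_, hc, hpos, hT⟩

/-- **Item 4842 `RatioRotationInvariance` from any non-degenerate `O(3)`-invariant pointwise scaling limit.** [folklore] -/
theorem CCIRatioRotation_of_scalingLimit {ρ : ℝ → ℝ} {S : CorrFamily 3} (hρ : ∀ δ ∈ Set.Ioc (0 : ℝ) 1, 0 < ρ δ)
    (hlim : HasPointwiseScalingLimit (criticalCorr 3) ρ S) (hnd : IsNondegenerateTwoPoint S) (hrot : IsRotationInvariant S) :
    CurrentConnectionInvariance.RatioRotationInvariance :=
  stub_CCIRatioRotationOfLimit S hrot fun n hn => (stub_telescopingLimitOfScalingLimit ρ S hρ hlim hnd n hn).2.2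

/-- **Item 4840 `RatioInversionInvariance` from any non-degenerate inversion covariant pointwise scaling limit.** [folklore] -/
theorem CCIRatioInversion_of_scalingLimit {ρ : ℝ → ℝ} {Δ : ℝ} {S : CorrFamily 3} (hρ : ∀ δ ∈ Set.Ioc (0 : ℝ) 1, 0 < ρ δ)
    (hlim : HasPointwiseScalingLimit (criticalCorr 3) ρ S) (hnd : IsNondegenerateTwoPoint S)
    (hinv : IsInversionCovariant Δ S) : CurrentConnectionInvariance.RatioInversionInvariance :=
  stub_CCIRatioInversionOfLimit Δ S hinv fun n hn => (stub_telescopingLimitOfScalingLimit ρ S hρ hlim hnd n hn).2.2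

/-- **Ratio limits ⇒ item 4841** (through the pinned limit); with the bridge `ratioLimitExists_of_CCIRatioLimit` the
existence half of the crux is equivalent to item 4841. [folklore] -/
theorem CCIRatioLimit_of_ratioLimits
    (hL : ∃ q : CorrFamily 3, ∀ m : ℕ, TendstoLocallyUniformlyOn (fun (δ : ℝ) (x : Fin (m + m) → EuclideanSpace ℝ (Fin 3)) =>
      criticalCorr 3 (m + m) (fun i => latticeApprox δ (x i)) /
        ∏ j : Fin m, criticalCorr 3 2 ![latticeApprox δ (x (Fin.castAdd m j)), latticeApprox δ (x (Fin.natAdd m j))])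
      (q (m + m)) (𝓝[>] (0 : ℝ)) (NonCoincident 3 (m + m))) :
    CurrentConnectionInvariance.RatioLimit := by
  obtain ⟨q, hq⟩ := hL
  obtain ⟨ρ, Δ, ψ, S, hρ, hS, -, hnd, -⟩ := pinnedLimit_of_ratioLimits hq
  exact CCIRatioLimit_of_scalingLimit hρ hS hnd

/-- **The existence half of the crux ⇔ item stmt-CriticalPhenomena-4841 `RatioLimit`.** [folklore] -/
theorem ratioLimits_iff_CCIRatioLimit :
    (∃ q : CorrFamily 3, ∀ m : ℕ, TendstoLocallyUniformlyOn (fun (δ : ℝ) (x : Fin (m + m) → EuclideanSpace ℝ (Fin 3)) =>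
      criticalCorr 3 (m + m) (fun i => latticeApprox δ (x i)) /
        ∏ j : Fin m, criticalCorr 3 2 ![latticeApprox δ (x (Fin.castAdd m j)), latticeApprox δ (x (Fin.natAdd m j))])
      (q (m + m)) (𝓝[>] (0 : ℝ)) (NonCoincident 3 (m + m))) ↔ CurrentConnectionInvariance.RatioLimit :=
  ⟨CCIRatioLimit_of_ratioLimits, ratioLimitExists_of_CCIRatioLimit⟩

/-- **Item 4841 ⇒ item 4842** inside route `CurrentConnectionInvariance`: rotation invariance of the telescoping ratios is
FREE given their limits (the pinned limit is `O(3)` invariant by the `HyperoctahedralRP` rigidity). [folklore] -/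
theorem CCIRatioRotation_of_CCIRatioLimit (hRL : CurrentConnectionInvariance.RatioLimit) :
    CurrentConnectionInvariance.RatioRotationInvariance := by
  obtain ⟨q, hq⟩ := ratioLimitExists_of_CCIRatioLimit hRL
  obtain ⟨ρ, Δ, ψ, S, hρ, hS, -, hnd, -, -, hrot, -⟩ := pinnedLimit_of_ratioLimits hq
  exact CCIRatioRotation_of_scalingLimit hρ hS hnd hrot

/-- **Item 1344 ⇒ items 4841 ∧ 4842 ∧ 4840.** [folklore] -/
theorem CCI_items_of_moebiusLimit (h : EnergyNotSigmaSquared.MoebiusLimit) :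
    CurrentConnectionInvariance.RatioLimit ∧ CurrentConnectionInvariance.RatioRotationInvariance ∧
      CurrentConnectionInvariance.RatioInversionInvariance := by
  obtain ⟨_, _, _, hρ, _, hlim, hnd, hM⟩ := h
  exact ⟨CCIRatioLimit_of_scalingLimit hρ hlim hnd, CCIRatioRotation_of_scalingLimit hρ hlim hnd hM.1.2,
    CCIRatioInversion_of_scalingLimit hρ hlim hnd hM.2.2⟩

/-- **Items 4841 ∧ 4840 ⇒ the crux** (route `CurrentConnectionInvariance` alone; kill criterion (d) of `LinkingParityCircles`):
the bridge gives the ratio limits, item 4840 and the GKS bound give asymptotic inversion invariance of the pairing ratios. [folklore] -/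
theorem SpinRatioMoebius_of_CCI_items (hRL : CurrentConnectionInvariance.RatioLimit)
    (hRI : CurrentConnectionInvariance.RatioInversionInvariance) : LinkingParityCircles.SpinRatioMoebius :=
  SpinRatioMoebius_of_ratioLimits_of_ratioInversion (ratioLimitExists_of_CCIRatioLimit hRL)
    (stub_ratioInversionOfCCI stub_prodPairsLe (ratioLimitExists_of_CCIRatioLimit hRL) hRI)

/-- **`SpinRatioMoebius ⇔ RatioLimit (4841) ∧ RatioInversionInvariance (4840)`.** [folklore] -/
theorem SpinRatioMoebius_iff_CCI_items :
    Summit.CriticalPhenomena.Ising3DConformalLimit.Theses.LinkingParityCircles.SpinRatioMoebius ↔ Summit.CriticalPhenomena.Ising3DConformalLimit.Theses.CurrentConnectionInvariance.RatioLimit ∧ Summit.CriticalPhenomena.Ising3DConformalLimit.Theses.CurrentConnectionInvariance.RatioInversionInvariance :=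
  ⟨fun h => ⟨(CCI_items_of_moebiusLimit (moebiusLimit_of_SpinRatioMoebius h)).1,
      (CCI_items_of_moebiusLimit (moebiusLimit_of_SpinRatioMoebius h)).2.2⟩,
    fun h => SpinRatioMoebius_of_CCI_items h.1 h.2⟩

/-- **`MoebiusLimit (1344) ⇔ RatioLimit (4841) ∧ RatioInversionInvariance (4840)`.** [folklore] -/
theorem moebiusLimit_iff_CCI_items :
    EnergyNotSigmaSquared.MoebiusLimit ↔
      CurrentConnectionInvariance.RatioLimit ∧ CurrentConnectionInvariance.RatioInversionInvariance :=
  SpinRatioMoebius_iff_moebiusLimit.symm.trans SpinRatioMoebius_iff_CCI_items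

/-- The crux also gives item 4842. [folklore] -/
theorem CCIRatioRotation_of_SpinRatioMoebius (h : LinkingParityCircles.SpinRatioMoebius) :
    CurrentConnectionInvariance.RatioRotationInvariance :=
  (CCI_items_of_moebiusLimit (moebiusLimit_of_SpinRatioMoebius h)).2.1

end Summit.CriticalPhenomena.Ising3DConformalLimit.Cruxes.SpinRatioMoebius.Birth

end
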